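import Mathlib
import Literature.Analysis.Complex.OffCentreCauchyFormula
import HarnessLib

/-!
# The lemma on the logarithmic derivative — functional-unit case (Calegari–Dimitrov–Tang)

`Literature/Analysis/Complex/LogDerivativeLemma.lean`. Everything here is PROVED (no definition,
no named fact). The main result is the self-contained special case of R. Nevanlinna's *lemma on the
logarithmic derivative* that F. Calegari, V. Dimitrov and Y. Tang prove and use in
*The unbounded denominators conjecture* (J. Amer. Math. Soc. **38** (2025), 627–702;
arXiv:2109.09040), §6.1, Lemma 6.1.2 of the published numbering, as the engine of their
Theorem 6.0.1 (uniform mean growth of the universal covering map of `ℂ ∖ μ_N` near the boundary):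

> **Lemma 6.1.2.** Let `g : D̄(0, R) → ℂˣ` be a nowhere vanishing holomorphic function on some
> open neighbourhood of the closed disc `|z| ≤ R`, with `g(0) = 1`. Then, for all `0 < r < R`,
> `m(r, g'/g) < log⁺ { m(R, g)/r · R/(R − r) } + log 2 + 1/e`,

where `m(ρ, F) = ∫_{|z| = ρ} log⁺ |F| μ_Haar` is the mean proximity function (Mathlib:
`Real.circleAverage (fun z ↦ log⁺ ‖F z‖) 0 ρ`, which is `ValueDistribution.proximity F ⊤ ρ`).
This is `circleAverage_posLog_norm_logDeriv_lt` below; the proof is the printed one: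

1. `deriv_eq_circleAverage_kernel_re` — the *reproducing kernel for the logarithmic derivative*
   (op. cit. (6.4)): for `h` holomorphic about `|w| ≤ R` and `|z| < R`,
   `h'(z) = ∫_{|w|=R} 2w/(w − z)² · Re h(w) μ_Haar(w)`. (CDT differentiate the holomorphic upgrade
   (6.3) of Poisson's formula; we obtain (6.4) directly from Cauchy's formula for `h'` —
   `Literature.Analysis.Complex.circleIntegral_div_sub_pow_eq_iteratedDeriv` — and the observation
   that on `|w| = R`, `conj(w/(w − z)²) = R² w/(R² − z̄ w)²` is the boundary value of a function
   holomorphic in `|w| ≤ R` vanishing at `0`, whose product with `h` has circle average `0`.)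
   Applied to a holomorphic logarithm `h = log g` (`Re h = log |g|`, `h' = g'/g`).
2. `circleAverage_inv_norm_sub_sq` — the kernel computation (op. cit. (6.5)):
   `∫_{|z|=r} |w − z|⁻² μ_Haar(z) = 1/(R² − r²)` for `|w| = R > r` (mean value property of
   `z ↦ (w + z)/(w − z)`, whose real part is `(R² − r²)/|w − z|²`).
3. Fubini (`circleAverage_circleAverage_swap`) and `∫_{|w|=R} |log|g|| = m(R, g) + m(R, 1/g)`
   `= 2 m(R, g)` (harmonicity: `∫ log|g| = log|g(0)| = 0`), giving
   `∫_{|z|=r} |g'/g| ≤ 4R m(R, g)/(R² − r²)`.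
4. `circleAverage_posLog_le_posLog_circleAverage_add` — the concluding step borrowed by CDT from
   Benbourenane–Korhonen: `∫ log⁺|q| ≤ log⁺ ∫ |q| + 1/e` on a circle (Jensen's inequality for the
   concave `log` on the set where `|q| > 1`, and `t log(1/t) ≤ 1/e`).
5. `R² − r² > 2r(R − r)`.

## References

* [CalegariDimitrovTang2025] F. Calegari, V. Dimitrov, Y. Tang, The unbounded denominators
  conjecture, J. Amer. Math. Soc. 38 (2025), no. 3, 627–702, §6.1, Lemma 6.1.2 and its proof
  (displays (6.2)–(6.5)); arXiv:2109.09040.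
* R. Nevanlinna, *Eindeutige analytische Funktionen*, 2nd ed., Springer 1953, §IX.3.1 (the general
  lemma); A. A. Goldberg, V. A. Grinshtein, The logarithmic derivative of a meromorphic function,
  Mat. Zametki 19 (1976) (the sharp general form quoted by CDT as (6.6)).
-/

noncomputable section

open Complex Metric Real Set Filter Topology MeasureTheory

namespace Literature.Analysis.Complex

/-! ### 1. Two small facts about circle averages -/

/-- `‖⨍ f‖ ≤ ⨍ ‖f‖` for circle averages. [folklore] -/
theorem norm_circleAverage_le_circleAverage_norm {E : Type*} [NormedAddCommGroup E]
    [NormedSpace ℝ E] (f : ℂ → E) (c : ℂ) (R : ℝ) :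
    ‖circleAverage f c R‖ ≤ circleAverage (fun z ↦ ‖f z‖) c R := by
  rw [circleAverage_def, circleAverage_def, norm_smul, norm_inv, Real.norm_of_nonneg (by positivity),
    smul_eq_mul]
  gcongr
  exact intervalIntegral.norm_integral_le_integral_norm (by positivity)

/-- Swapping two circle averages of a jointly continuous integrand (Fubini on the torus).
[folklore] -/
theorem circleAverage_circleAverage_swap {F : ℂ → ℂ → ℝ} {c₁ c₂ : ℂ} {r R : ℝ}
    (hF : Continuous fun p : ℝ × ℝ ↦ F (circleMap c₁ r p.1) (circleMap c₂ R p.2)) :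
    circleAverage (fun z ↦ circleAverage (fun w ↦ F z w) c₂ R) c₁ r =
      circleAverage (fun w ↦ circleAverage (fun z ↦ F z w) c₁ r) c₂ R := by
  have hint : IntegrableOn (fun p : ℝ × ℝ ↦ F (circleMap c₁ r p.1) (circleMap c₂ R p.2))
      (uIoc 0 (2 * π) ×ˢ uIoc 0 (2 * π)) volume := by
    refine ((hF.continuousOn (s := Icc 0 (2 * π) ×ˢ Icc 0 (2 * π))).integrableOn_compact
      (isCompact_Icc.prod isCompact_Icc)).mono_set ?_
    rw [uIoc_of_le two_pi_pos.le]
    exact prod_mono Ioc_subset_Icc_self Ioc_subset_Icc_self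
  simp only [circleAverage_def, smul_eq_mul]
  rw [intervalIntegral.integral_const_mul, intervalIntegral.integral_const_mul]
  congr 2
  exact MeasureTheory.intervalIntegral_intervalIntegral_swap hint

/-! ### 2. Cauchy's formula for the derivative, as a circle average -/

/-- Cauchy's integral formula for `h'(z)`, `|z| < R`, written as a circle average over `|w| = R`:
`⨍ w/(w − z)² · h(w) = h'(z)` (`dw = i w dθ`). [folklore] -/
theorem circleAverage_div_sub_sq_mul_eq_deriv {U : Set ℂ} (hU : IsOpen U) {h : ℂ → ℂ}
    (hh : DifferentiableOn ℂ h U) {R : ℝ} (hRU : closedBall (0 : ℂ) R ⊆ U) (hR : 0 < R) {z : ℂ}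
    (hz : z ∈ ball (0 : ℂ) R) :
    circleAverage (fun w ↦ w / (w - z) ^ 2 * h w) 0 R = deriv h z := by
  rw [circleAverage_eq_circleIntegral hR.ne']
  have key := circleIntegral_div_sub_pow_eq_iteratedDeriv hU hh hRU hz 1
  simp only [Nat.factorial_one, Nat.cast_one, div_one, iteratedDeriv_one] at key
  have hcongr : (∮ w in C(0, R), (w - 0)⁻¹ • (w / (w - z) ^ 2 * h w)) =
      ∮ w in C(0, R), h w / (w - z) ^ (1 + 1) := by
    apply circleIntegral.integral_congr hR.le
    intro w hw
    have hw0 : w ≠ 0 := by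
      rintro rfl
      simp [hR.ne] at hw
    simp only [sub_zero, smul_eq_mul]
    field_simp
  have h2pi : (2 * (π : ℂ) * I) ≠ 0 := by simp [Real.pi_ne_zero, I_ne_zero]
  rw [hcongr, key, smul_eq_mul, ← mul_assoc, inv_mul_cancel₀ h2pi, one_mul]

/-! ### 3. The conjugate kernel on the circle `|w| = R` -/

/-- On `|w| = R`: `conj(w/(w − z)²) = R² w/(R² − z̄ w)²` (since `w̄ = R²/w`). [folklore] -/
theorem conj_div_sub_sq_eq {R : ℝ} (hR : 0 < R) {z w : ℂ} (hz : z ∈ ball (0 : ℂ) R)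
    (hw : w ∈ sphere (0 : ℂ) R) :
    (starRingEnd ℂ) (w / (w - z) ^ 2) =
      (R : ℂ) ^ 2 * w / ((R : ℂ) ^ 2 - (starRingEnd ℂ) z * w) ^ 2 := by
  have hwR : ‖w‖ = R := by simpa using hw
  have hw0 : w ≠ 0 := by
    rintro rfl
    simp [hR.ne] at hwR
  have hcw : (starRingEnd ℂ) w = (R : ℂ) ^ 2 / w := by
    rw [eq_div_iff hw0, mul_comm, Complex.mul_conj, Complex.normSq_eq_norm_sq, hwR]
    push_cast
    ring
  have hne : (R : ℂ) ^ 2 - (starRingEnd ℂ) z * w ≠ 0 := by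
    intro h0
    have h1 : ‖(starRingEnd ℂ) z * w‖ = R ^ 2 := by
      rw [← sub_eq_zero.mp h0]
      simp
    rw [norm_mul, Complex.norm_conj, hwR] at h1
    have hz' : ‖z‖ < R := by simpa using hz
    nlinarith [norm_nonneg z]
  rw [map_div₀, map_pow, map_sub, hcw]
  field_simp

/-- For `h` continuous on `|w| ≤ R` and holomorphic inside, and `|z| < R`, the circle average over
`|w| = R` of `conj(w/(w − z)²) · h(w)` vanishes: on the circle the integrand agrees with
`R² w/(R² − z̄ w)² · h(w)`, holomorphic in `|w| ≤ R` and `0` at the centre. [folklore] -/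
theorem circleAverage_conj_div_sub_sq_mul_eq_zero {h : ℂ → ℂ} {R : ℝ} (hR : 0 < R)
    (hh : DiffContOnCl ℂ h (ball (0 : ℂ) R)) {z : ℂ} (hz : z ∈ ball (0 : ℂ) R) :
    circleAverage (fun w ↦ (starRingEnd ℂ) (w / (w - z) ^ 2) * h w) 0 R = 0 := by
  have hne : ∀ w ∈ closedBall (0 : ℂ) R, (R : ℂ) ^ 2 - (starRingEnd ℂ) z * w ≠ 0 := by
    intro w hw h0
    have h1 : ‖(starRingEnd ℂ) z * w‖ = R ^ 2 := by
      rw [← sub_eq_zero.mp h0]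
      simp
    rw [norm_mul, Complex.norm_conj] at h1
    have hz' : ‖z‖ < R := by simpa using hz
    have hw' : ‖w‖ ≤ R := by simpa using hw
    nlinarith [norm_nonneg z, norm_nonneg w, mul_le_mul_of_nonneg_left hw' (norm_nonneg z)]
  calc circleAverage (fun w ↦ (starRingEnd ℂ) (w / (w - z) ^ 2) * h w) 0 R
      = circleAverage (fun w ↦ (R : ℂ) ^ 2 * w / ((R : ℂ) ^ 2 - (starRingEnd ℂ) z * w) ^ 2 * h w)
          0 R := by
        apply circleAverage_congr_sphere
        intro w hw
        rw [abs_of_pos hR] at hw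
        simp only [conj_div_sub_sq_eq hR hz hw]
    _ = (fun w ↦ (R : ℂ) ^ 2 * w / ((R : ℂ) ^ 2 - (starRingEnd ℂ) z * w) ^ 2 * h w) 0 := by
        apply DiffContOnCl.circleAverage
        rw [abs_of_pos hR]
        have hKd : DifferentiableOn ℂ
            (fun w ↦ (R : ℂ) ^ 2 * w / ((R : ℂ) ^ 2 - (starRingEnd ℂ) z * w) ^ 2)
            (closedBall (0 : ℂ) R) := by
          intro w hw
          refine DifferentiableAt.differentiableWithinAt ?_
          refine DifferentiableAt.div (by fun_prop) (by fun_prop) (pow_ne_zero 2 (hne w hw))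
        refine ⟨(hKd.mono ball_subset_closedBall).mul hh.differentiableOn, ?_⟩
        rw [closure_ball (0 : ℂ) hR.ne']
        exact hKd.continuousOn.mul (by simpa [closure_ball (0 : ℂ) hR.ne'] using hh.continuousOn)
    _ = 0 := by simp

/-! ### 4. The reproducing kernel for the logarithmic derivative (CDT (6.4)) -/

/-- **The derivative of the Poisson–Schwarz representation** (CDT display (6.4), for `h = log g`):
if `h` is holomorphic on an open neighbourhood of `|w| ≤ R` and `|z| < R`, then
`h'(z) = ∫_{|w|=R} 2w/(w − z)² · Re h(w) μ_Haar(w)`.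
Proof: `2 Re h = h + h̄`; the `h`-part is Cauchy's formula for `h'(z)`, and the `h̄`-part is the
conjugate of `⨍ conj(w/(w−z)²) h(w) = 0`. [cite: CalegariDimitrovTang2025, §6.1, (6.4)] -/
theorem deriv_eq_circleAverage_kernel_re {U : Set ℂ} (hU : IsOpen U) {h : ℂ → ℂ}
    (hh : DifferentiableOn ℂ h U) {R : ℝ} (hRU : closedBall (0 : ℂ) R ⊆ U) (hR : 0 < R) {z : ℂ}
    (hz : z ∈ ball (0 : ℂ) R) :
    deriv h z = circleAverage (fun w ↦ 2 * w / (w - z) ^ 2 * ((h w).re : ℂ)) 0 R := by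
  have hz' : ‖z‖ < R := by simpa using hz
  have hsub : ∀ w ∈ sphere (0 : ℂ) R, w - z ≠ 0 := by
    intro w hw h0
    have : ‖w‖ = R := by simpa using hw
    rw [sub_eq_zero.mp h0] at this
    linarith
  have hcont : ContinuousOn h (sphere (0 : ℂ) R) :=
    hh.continuousOn.mono (sphere_subset_closedBall.trans hRU)
  have hK : ContinuousOn (fun w ↦ w / (w - z) ^ 2) (sphere (0 : ℂ) R) :=
    continuousOn_id.div ((continuousOn_id.sub continuousOn_const).pow 2)
      fun w hw ↦ pow_ne_zero 2 (hsub w hw)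
  have hint1 : CircleIntegrable (fun w ↦ w / (w - z) ^ 2 * h w) 0 R :=
    (hK.mul hcont).circleIntegrable hR.le
  have hint2 : CircleIntegrable (fun w ↦ (starRingEnd ℂ) (w / (w - z) ^ 2) * h w) 0 R :=
    ((Complex.continuous_conj.comp_continuousOn hK).mul hcont).circleIntegrable hR.le
  have hint3 : CircleIntegrable
      (fun w ↦ (starRingEnd ℂ) ((starRingEnd ℂ) (w / (w - z) ^ 2) * h w)) 0 R :=
    (Complex.continuous_conj.comp_continuousOn
      ((Complex.continuous_conj.comp_continuousOn hK).mul hcont)).circleIntegrable hR.le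
  have hsplit : (fun w ↦ 2 * w / (w - z) ^ 2 * ((h w).re : ℂ)) =
      (fun w ↦ w / (w - z) ^ 2 * h w) +
        fun w ↦ (starRingEnd ℂ) ((starRingEnd ℂ) (w / (w - z) ^ 2) * h w) := by
    funext w
    simp only [Pi.add_apply, map_mul, Complex.conj_conj, Complex.re_eq_add_conj]
    ring
  have hconj : circleAverage (fun w ↦ (starRingEnd ℂ) ((starRingEnd ℂ) (w / (w - z) ^ 2) * h w))
      0 R = (starRingEnd ℂ) (circleAverage (fun w ↦ (starRingEnd ℂ) (w / (w - z) ^ 2) * h w) 0 R) := by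
    have := ContinuousLinearMap.circleAverage_comp_comm
      (Complex.conjCLE.toContinuousLinearMap : ℂ →L[ℝ] ℂ) hint2
    simpa [Function.comp_def] using this
  have hdc : DiffContOnCl ℂ h (ball (0 : ℂ) R) := by
    refine DifferentiableOn.diffContOnCl (hh.mono ?_)
    rw [closure_ball 0 hR.ne']
    exact hRU
  rw [hsplit, circleAverage_add hint1 hint3, circleAverage_div_sub_sq_mul_eq_deriv hU hh hRU hR hz,
    hconj, circleAverage_conj_div_sub_sq_mul_eq_zero hR hdc hz, map_zero, add_zero]

/-! ### 5. The mass of the kernel on an inner circle (CDT (6.5)) -/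

/-- **The kernel computation** (CDT display (6.5)): for `|w| = R > r ≥ 0`,
`∫_{|z|=r} |w − z|⁻² μ_Haar(z) = 1/(R² − r²)`. Proof: `(R² − r²)/|w − z|² = Re((w + z)/(w − z))`
on `|z| = r`, and `z ↦ (w + z)/(w − z)` is holomorphic on `|z| ≤ r`, so its circle average is its
value `1` at the centre. [cite: CalegariDimitrovTang2025, §6.1, (6.5)] -/
theorem circleAverage_inv_norm_sub_sq {w : ℂ} {r R : ℝ} (hr : 0 ≤ r) (hrR : r < R)
    (hw : ‖w‖ = R) : circleAverage (fun z ↦ (‖w - z‖ ^ 2)⁻¹) 0 r = (R ^ 2 - r ^ 2)⁻¹ := by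
  have hRr : 0 < R ^ 2 - r ^ 2 := by nlinarith
  have hw0 : w ≠ 0 := by
    rintro rfl
    simp at hw
    linarith
  have hwz : ∀ z ∈ closedBall (0 : ℂ) r, w - z ≠ 0 := by
    intro z hz h0
    have hz' : ‖z‖ ≤ r := by simpa using hz
    rw [sub_eq_zero.mp h0] at hw
    linarith
  -- the holomorphic function `z ↦ (w + z)/(w - z)` on `|z| ≤ r`
  have hdiff : DifferentiableOn ℂ (fun z ↦ (w + z) / (w - z)) (closedBall (0 : ℂ) r) := by
    intro z hz
    have := hwz z hz
    fun_prop (disch := assumption)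
  have hF : DiffContOnCl ℂ (fun z ↦ (w + z) / (w - z)) (ball (0 : ℂ) |r|) := by
    rw [abs_of_nonneg hr]
    exact DifferentiableOn.diffContOnCl (hdiff.mono closure_ball_subset_closedBall)
  have hmean : circleAverage (fun z ↦ (w + z) / (w - z)) 0 r = 1 := by
    rw [hF.circleAverage]
    simp [div_self hw0]
  have hint : CircleIntegrable (fun z ↦ (w + z) / (w - z)) 0 r :=
    (hdiff.continuousOn.mono sphere_subset_closedBall).circleIntegrable hr
  have hre : circleAverage (fun z ↦ ((w + z) / (w - z)).re) 0 r = 1 := by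
    have := ContinuousLinearMap.circleAverage_comp_comm Complex.reCLM hint
    simp only [Complex.reCLM_apply, hmean, Complex.one_re] at this
    simpa [Function.comp_def] using this
  -- on the circle `|z| = r` the real part is `(R² − r²)/|w − z|²`
  have hsphere : ∀ z ∈ sphere (0 : ℂ) |r|,
      ((w + z) / (w - z)).re = (R ^ 2 - r ^ 2) • (‖w - z‖ ^ 2)⁻¹ := by
    intro z hz
    rw [abs_of_nonneg hr] at hz
    have hz' : ‖z‖ = r := by simpa using hz
    have key := congr_fun (poissonKernel_eq_re_herglotzRieszKernel (c := 0) (w := z)) w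
    simp only [poissonKernel, herglotzRieszKernel, sub_zero, Function.comp_apply] at key
    rw [← key, hw, hz', smul_eq_mul, div_eq_mul_inv]
  rw [circleAverage_congr_sphere hsphere, circleAverage_fun_smul, smul_eq_mul] at hre
  exact (eq_inv_of_mul_eq_one_right hre)

/-! ### 6. The concluding convexity step: `⨍ log⁺ q ≤ log⁺ ⨍ q + 1/e` -/

/-- `t log(1/t) ≤ 1/e` for `t > 0` (the maximum of `t log(1/t)` on `(0, 1]`, at `t = 1/e`).
[folklore] -/
theorem mul_log_inv_le_exp_neg_one {t : ℝ} (ht : 0 < t) : t * Real.log t⁻¹ ≤ Real.exp (-1) := by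
  have h := Real.log_le_sub_one_of_pos (show 0 < t⁻¹ * Real.exp (-1) by positivity)
  rw [Real.log_mul (by positivity) (by positivity), Real.log_exp] at h
  have h2 : Real.log t⁻¹ ≤ t⁻¹ * Real.exp (-1) := by linarith
  calc t * Real.log t⁻¹ ≤ t * (t⁻¹ * Real.exp (-1)) := by gcongr
    _ = Real.exp (-1) := by field_simp

/-- **Jensen's inequality on the set where `q > 1`** (the last step of the proof of CDT
Lemma 6.1.2, after Benbourenane–Korhonen): for a continuous `q ≥ 0` on a circle,
`⨍ log⁺ q ≤ log⁺ (⨍ q) + 1/e`. Indeed, with `E = {q > 1}` of normalised measure `t`,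
`⨍ log⁺ q = t · ⨍_E log q ≤ t log(⨍_E q) ≤ t log⁺(t⁻¹ ⨍ q) ≤ log⁺ ⨍ q + t log(1/t)`.
[cite: CalegariDimitrovTang2025, §6.1, proof of Lemma 6.1.2] -/
theorem circleAverage_posLog_le_posLog_circleAverage_add {q : ℂ → ℝ} {c : ℂ} {r : ℝ}
    (hq : Continuous fun θ : ℝ ↦ q (circleMap c r θ)) (hq0 : ∀ θ, 0 ≤ q (circleMap c r θ)) :
    circleAverage (fun z ↦ log⁺ (q z)) c r ≤ log⁺ (circleAverage q c r) + Real.exp (-1) := by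
  set Q : ℝ → ℝ := fun θ ↦ q (circleMap c r θ) with hQ
  set μ : Measure ℝ := volume.restrict (Ioc 0 (2 * π)) with hμ
  haveI : IsFiniteMeasure μ := isFiniteMeasure_restrict.mpr measure_Ioc_lt_top.ne
  set A := circleAverage q c r with hA
  have hA' : A = (2 * π)⁻¹ * ∫ θ, Q θ ∂μ := by
    rw [hA, circleAverage_def, smul_eq_mul, intervalIntegral.integral_of_le two_pi_pos.le]
  have hLHS : circleAverage (fun z ↦ log⁺ (q z)) c r = (2 * π)⁻¹ * ∫ θ, log⁺ (Q θ) ∂μ := by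
    rw [circleAverage_def, smul_eq_mul, intervalIntegral.integral_of_le two_pi_pos.le]
  -- the set where `q > 1`
  have hEm : MeasurableSet {θ | 1 < Q θ} := (isOpen_lt continuous_const hq).measurableSet
  have hind : (fun θ ↦ log⁺ (Q θ)) = {θ | 1 < Q θ}.indicator fun θ ↦ Real.log (Q θ) := by
    funext θ
    by_cases hθ : θ ∈ {θ | 1 < Q θ}
    · rw [indicator_of_mem hθ]
      exact posLog_eq_log (by rw [abs_of_nonneg (hq0 θ)]; exact le_of_lt hθ)
    · rw [indicator_of_notMem hθ]
      exact (posLog_eq_zero_iff _).mpr (by rw [abs_of_nonneg (hq0 θ)]; exact not_lt.mp hθ)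
  have hint_eq : ∫ θ, log⁺ (Q θ) ∂μ = ∫ θ in {θ | 1 < Q θ}, Real.log (Q θ) ∂μ := by
    rw [hind, integral_indicator hEm]
  -- integrability
  have hQi : Integrable Q μ :=
    (hq.integrableOn_Icc (a := 0) (b := 2 * π)).mono_set Ioc_subset_Icc_self
  have hposc : Continuous fun θ ↦ log⁺ (Q θ) :=
    (by fun_prop : Continuous fun x : ℝ ↦ log⁺ x).comp hq
  have hposi : Integrable (fun θ ↦ log⁺ (Q θ)) μ :=
    (hposc.integrableOn_Icc (a := 0) (b := 2 * π)).mono_set Ioc_subset_Icc_self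
  have hA0 : 0 ≤ A := by
    rw [hA']
    exact mul_nonneg (by positivity) (integral_nonneg fun θ ↦ hq0 θ)
  have hRHS0 : 0 ≤ log⁺ A + Real.exp (-1) := add_nonneg posLog_nonneg (Real.exp_pos _).le
  by_cases hE0 : μ {θ | 1 < Q θ} = 0
  · -- `q ≤ 1` almost everywhere: the left-hand side vanishes
    rw [hLHS, hint_eq, setIntegral_measure_zero _ hE0, mul_zero]
    exact hRHS0
  · have hEtop : μ {θ | 1 < Q θ} ≠ ⊤ := measure_ne_top μ _
    set t := μ.real {θ | 1 < Q θ} with ht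
    have ht0 : 0 < t := by
      rw [ht, measureReal_def]
      exact ENNReal.toReal_pos hE0 hEtop
    have ht2pi : t ≤ 2 * π := by
      calc t ≤ μ.real univ := measureReal_mono (subset_univ _) (measure_ne_top μ _)
        _ = 2 * π := by
          rw [hμ, measureReal_restrict_apply_univ, Real.volume_real_Ioc_of_le two_pi_pos.le,
            sub_zero]
    -- Jensen on `E` for the concave `log` on `[1, ∞)`
    have hconc : ConcaveOn ℝ (Ici (1 : ℝ)) Real.log :=
      strictConcaveOn_log_Ioi.concaveOn.subset (Ici_subset_Ioi.mpr one_pos) (convex_Ici 1)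
    have hlogc : ContinuousOn Real.log (Ici (1 : ℝ)) :=
      Real.continuousOn_log.mono fun x hx ↦ ne_of_gt (lt_of_lt_of_le one_pos hx)
    have hmem : ∀ᵐ θ ∂μ.restrict {θ | 1 < Q θ}, Q θ ∈ Ici (1 : ℝ) := by
      filter_upwards [ae_restrict_mem hEm] with θ hθ
      exact le_of_lt hθ
    have hlogi : IntegrableOn (Real.log ∘ Q) {θ | 1 < Q θ} μ := by
      refine (hposi.integrableOn (s := {θ | 1 < Q θ})).congr_fun (fun θ hθ ↦ ?_) hEm
      simp only [Function.comp_apply]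
      exact posLog_eq_log (by rw [abs_of_nonneg (hq0 θ)]; exact le_of_lt hθ)
    have hJ := hconc.le_map_set_average hlogc isClosed_Ici hE0 hEtop hmem hQi.integrableOn hlogi
    rw [setAverage_eq, setAverage_eq, smul_eq_mul, smul_eq_mul] at hJ
    -- hJ : t⁻¹ * ∫_E log Q ≤ log (t⁻¹ * ∫_E Q)
    set IE := ∫ θ in {θ | 1 < Q θ}, Q θ ∂μ with hIE
    have hIE_ge : t ≤ IE := by
      have h1 : ∫ θ in {θ | 1 < Q θ}, (1 : ℝ) ∂μ ≤ IE :=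
        setIntegral_mono_on (integrableOn_const (measure_ne_top μ _)) hQi.integrableOn hEm
          fun θ hθ ↦ le_of_lt hθ
      simpa [setIntegral_const, ht] using h1
    have hIE_le : IE ≤ 2 * π * A := by
      have h1 : IE ≤ ∫ θ, Q θ ∂μ := setIntegral_le_integral hQi (Eventually.of_forall hq0)
      have h2 : 2 * π * A = ∫ θ, Q θ ∂μ := by
        rw [hA']
        field_simp
      linarith
    have hIEpos : 0 < IE := ht0.trans_le hIE_ge
    have h1 : ∫ θ in {θ | 1 < Q θ}, Real.log (Q θ) ∂μ ≤ t * Real.log (t⁻¹ * IE) := by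
      have := mul_le_mul_of_nonneg_left hJ ht0.le
      rwa [← mul_assoc, mul_inv_cancel₀ ht0.ne', one_mul] at this
    have h2 : Real.log (t⁻¹ * IE) ≤ Real.log (t⁻¹ * (2 * π * A)) :=
      Real.log_le_log (by positivity) (by gcongr)
    set s := t / (2 * π) with hs
    have hs0 : 0 < s := by positivity
    have hs1 : s ≤ 1 := (div_le_one two_pi_pos).mpr ht2pi
    have hAs : t⁻¹ * (2 * π * A) = A / s := by
      rw [hs]
      field_simp
    have hlogle : Real.log (A / s) ≤ log⁺ (A / s) := by
      rw [posLog_apply]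
      exact le_max_right _ _
    have hsinv : log⁺ s⁻¹ = Real.log s⁻¹ :=
      posLog_eq_log (by rw [abs_of_pos (inv_pos.mpr hs0)]; exact (one_le_inv₀ hs0).mpr hs1)
    calc circleAverage (fun z ↦ log⁺ (q z)) c r
        = (2 * π)⁻¹ * ∫ θ in {θ | 1 < Q θ}, Real.log (Q θ) ∂μ := by rw [hLHS, hint_eq]
      _ ≤ (2 * π)⁻¹ * (t * Real.log (A / s)) := by
          rw [← hAs]
          gcongr (2 * π)⁻¹ * ?_
          exact h1.trans (mul_le_mul_of_nonneg_left h2 ht0.le)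
      _ = s * Real.log (A / s) := by
          rw [hs]
          ring
      _ ≤ s * log⁺ (A / s) := by gcongr
      _ ≤ s * (log⁺ A + log⁺ s⁻¹) := by
          gcongr
          rw [div_eq_mul_inv]
          exact posLog_mul
      _ = s * log⁺ A + s * Real.log s⁻¹ := by rw [mul_add, hsinv]
      _ ≤ 1 * log⁺ A + Real.exp (-1) :=
          add_le_add (mul_le_mul_of_nonneg_right hs1 posLog_nonneg)
            (mul_log_inv_le_exp_neg_one hs0)
      _ = log⁺ A + Real.exp (-1) := by rw [one_mul]

/-! ### 7. The elementary final comparison -/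

/-- For `0 < r < R` and `m ≥ 0`: `log⁺(4Rm/(R² − r²)) < log⁺(m/r · R/(R − r)) + log 2`, using
`R² − r² > 2r(R − r)`. [cite: CalegariDimitrovTang2025, §6.1, proof of Lemma 6.1.2, last line]
-/
theorem posLog_four_mul_div_lt {r R m : ℝ} (hr : 0 < r) (hrR : r < R) (hm : 0 ≤ m) :
    log⁺ (4 * R * m / (R ^ 2 - r ^ 2)) < log⁺ (m / r * (R / (R - r))) + Real.log 2 := by
  have hR : 0 < R := hr.trans hrR
  have hRr : 0 < R - r := sub_pos.mpr hrR
  have hRr2 : 2 * r * (R - r) < R ^ 2 - r ^ 2 := by nlinarith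
  have hden : 0 < R ^ 2 - r ^ 2 := by nlinarith
  set x := m / r * (R / (R - r)) with hx
  have hx0 : 0 ≤ x := by positivity
  have hlog2 : 0 < Real.log 2 := Real.log_pos one_lt_two
  -- `y := 4Rm/(R² − r²) ≤ 2x`, strictly when `m > 0`
  set y := 4 * R * m / (R ^ 2 - r ^ 2) with hy
  have hy0 : 0 ≤ y := by positivity
  rcases hm.eq_or_lt with hm0 | hm0
  · -- `m = 0`
    have : y = 0 := by rw [hy, ← hm0]; ring
    rw [this]
    have h0 : log⁺ (0 : ℝ) = 0 := by simp [posLog_apply]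
    rw [h0]
    linarith [posLog_nonneg (x := x)]
  · have hxpos : 0 < x := by positivity
    have hy2x : y < 2 * x := by
      rw [hy, hx, div_lt_iff₀ hden]
      have : 2 * (m / r * (R / (R - r))) * (R ^ 2 - r ^ 2) =
          4 * R * m * ((R ^ 2 - r ^ 2) / (2 * r * (R - r))) := by
        field_simp
        ring
      rw [this]
      have h1 : 1 < (R ^ 2 - r ^ 2) / (2 * r * (R - r)) := by
        rw [lt_div_iff₀ (by positivity)]
        linarith
      have h4 : 0 < 4 * R * m := by positivity
      nlinarith
    -- `log⁺ y < log (2x) ≤ log⁺ x + log 2` when `2x > 1`, and `log⁺ y < log 2` otherwise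
    by_cases h2x : 1 < 2 * x
    · have hlt : log⁺ y < Real.log (2 * x) := by
        rw [posLog_apply, max_lt_iff]
        refine ⟨Real.log_pos h2x, ?_⟩
        rcases hy0.eq_or_lt with hy00 | hy00
        · rw [← hy00, Real.log_zero]; exact Real.log_pos h2x
        · exact Real.log_lt_log hy00 hy2x
      have hle : Real.log (2 * x) ≤ log⁺ x + Real.log 2 := by
        rw [Real.log_mul two_ne_zero hxpos.ne', add_comm]
        gcongr
        rw [posLog_apply]
        exact le_max_right _ _
      exact hlt.trans_le hle
    · rw [not_lt] at h2x
      have hlt : log⁺ y < Real.log 2 := by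
        rw [posLog_apply, max_lt_iff]
        refine ⟨hlog2, ?_⟩
        rcases hy0.eq_or_lt with hy00 | hy00
        · rw [← hy00, Real.log_zero]; exact hlog2
        · exact Real.log_lt_log hy00 (by linarith)
      linarith [posLog_nonneg (x := x)]

/-! ### 8. The lemma on the logarithmic derivative for functional units -/

/-- **Lemma on the logarithmic derivative, functional-unit case** (Calegari–Dimitrov–Tang,
Lemma 6.1.2 of the published version): let `g` be holomorphic and nowhere vanishing on an open
neighbourhood of the closed disc `|z| ≤ R`, with `g(0) = 1`. Then for all `0 < r < R`,
`m(r, g'/g) < log⁺ { m(R, g)/r · R/(R − r) } + log 2 + 1/e`,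
where `m(ρ, F) = ∫_{|z|=ρ} log⁺ |F| μ_Haar` (here `Real.circleAverage (fun z ↦ log⁺ ‖F z‖) 0 ρ`).
[cite: CalegariDimitrovTang2025, Lemma 6.1.2] -/
theorem circleAverage_posLog_norm_logDeriv_lt {g : ℂ → ℂ} {r R : ℝ} (hr : 0 < r) (hrR : r < R)
    (hg : AnalyticOnNhd ℂ g (closedBall 0 R)) (hg0 : ∀ z ∈ closedBall (0 : ℂ) R, g z ≠ 0)
    (hg1 : g 0 = 1) :
    circleAverage (fun z ↦ log⁺ ‖deriv g z / g z‖) 0 r <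
      log⁺ (circleAverage (fun z ↦ log⁺ ‖g z‖) 0 R / r * (R / (R - r))) + Real.log 2 +
        Real.exp (-1) := by
  have hR : 0 < R := hr.trans hrR
  /- Step 0: a larger disc `|z| < R'` on which `g` is holomorphic and zero-free. -/
  obtain ⟨R', hRR', hg', hg0'⟩ : ∃ R' > R, (∀ z ∈ ball (0 : ℂ) R', AnalyticAt ℂ g z) ∧
      ∀ z ∈ ball (0 : ℂ) R', g z ≠ 0 := by
    set U : Set ℂ := {z | AnalyticAt ℂ g z} ∩ g ⁻¹' {0}ᶜ with hU
    have hUo : IsOpen U := by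
      refine ContinuousOn.isOpen_inter_preimage ?_ (isOpen_analyticAt ℂ g) isOpen_compl_singleton
      exact fun z hz ↦ (hz : AnalyticAt ℂ g z).continuousAt.continuousWithinAt
    have hsub : closedBall (0 : ℂ) R ⊆ U := fun z hz ↦ ⟨hg z hz, hg0 z hz⟩
    obtain ⟨δ, hδ, hδU⟩ := (isCompact_closedBall 0 R).exists_thickening_subset_open hUo hsub
    rw [thickening_closedBall hδ hR.le] at hδU
    exact ⟨δ + R, by linarith, fun z hz ↦ (hδU hz).1, fun z hz ↦ (hδU hz).2⟩
  /- Step 1: a holomorphic logarithm `h` of `g` on `|z| < R'`: `h(0) = 0`, `h' = g'/g`,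
  `g = exp h`, `Re h = log |g|`. -/
  have hLd : DifferentiableOn ℂ (fun z ↦ deriv g z / g z) (ball 0 R') := fun z hz ↦
    (((hg' z hz).deriv.differentiableAt).div (hg' z hz).differentiableAt
      (hg0' z hz)).differentiableWithinAt
  obtain ⟨h, hh0, hh⟩ := hLd.isExactOn_ball.with_val_at 0 0
  have hhd : DifferentiableOn ℂ h (ball 0 R') := fun z hz ↦
    (hh z hz).differentiableAt.differentiableWithinAt
  have hexp : ∀ z ∈ ball (0 : ℂ) R', g z = Complex.exp (h z) := by
    have hφd : DifferentiableOn ℂ (fun z ↦ g z * Complex.exp (-h z)) (ball 0 R') := fun z hz ↦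
      (((hg' z hz).differentiableAt).mul (hh z hz).differentiableAt.neg.cexp).differentiableWithinAt
    have hφ' : (ball (0 : ℂ) R').EqOn (deriv fun z ↦ g z * Complex.exp (-h z)) 0 := by
      intro z hz
      have h1 : HasDerivAt g (deriv g z) z := (hg' z hz).differentiableAt.hasDerivAt
      have h2 : HasDerivAt (fun z ↦ Complex.exp (-h z))
          (Complex.exp (-h z) * -(deriv g z / g z)) z := (hh z hz).neg.cexp
      rw [(h1.fun_mul h2).deriv, Pi.zero_apply]
      field_simp [hg0' z hz]
      ring
    intro z hz
    have := isOpen_ball.is_const_of_deriv_eq_zero (convex_ball (0 : ℂ) R').isPreconnected hφd hφ'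
      hz (mem_ball_self (hR.trans hRR'))
    simp only [hh0, hg1, neg_zero, Complex.exp_zero, mul_one] at this
    calc g z = g z * Complex.exp (-h z) * Complex.exp (h z) := by
          rw [mul_assoc, ← Complex.exp_add, neg_add_cancel, Complex.exp_zero, mul_one]
      _ = Complex.exp (h z) := by rw [this, one_mul]
  have hre : ∀ z ∈ ball (0 : ℂ) R', Real.log ‖g z‖ = (h z).re := fun z hz ↦ by
    rw [hexp z hz, Complex.norm_exp, Real.log_exp]
  have hderiv : ∀ z ∈ ball (0 : ℂ) R', deriv g z / g z = deriv h z := fun z hz ↦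
    ((hh z hz).deriv).symm
  have hbR : closedBall (0 : ℂ) R ⊆ ball 0 R' := closedBall_subset_ball hRR'
  have hsR : sphere (0 : ℂ) R ⊆ ball 0 R' := sphere_subset_closedBall.trans hbR
  have hsr : sphere (0 : ℂ) r ⊆ ball 0 R :=
    sphere_subset_closedBall.trans (closedBall_subset_ball hrR)
  -- continuity facts
  have hgc : ContinuousOn g (ball (0 : ℂ) R') := fun z hz ↦ (hg' z hz).continuousAt.continuousWithinAt
  have hdgc : ContinuousOn (fun z ↦ deriv g z / g z) (ball (0 : ℂ) R') := hLd.continuousOn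
  /- Step 2: the reproducing formula (6.4) for `g'/g` on `|z| < R`. -/
  have h64 : ∀ z ∈ ball (0 : ℂ) R, deriv g z / g z =
      circleAverage (fun w ↦ 2 * w / (w - z) ^ 2 * ((Real.log ‖g w‖ : ℝ) : ℂ)) 0 R := by
    intro z hz
    rw [hderiv z (ball_subset_ball hRR'.le hz),
      deriv_eq_circleAverage_kernel_re isOpen_ball hhd hbR hR hz]
    apply circleAverage_congr_sphere
    intro w hw
    rw [abs_of_pos hR] at hw
    simp only [hre w (hsR hw)]
  /- Step 3: pointwise, `|g'/g(z)| ≤ 2R ⨍_{|w|=R} |log|g(w)||/|w − z|²`. -/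
  have h3 : ∀ z ∈ ball (0 : ℂ) R, ‖deriv g z / g z‖ ≤
      circleAverage (fun w ↦ 2 * R * (‖w - z‖ ^ 2)⁻¹ * |Real.log ‖g w‖|) 0 R := by
    intro z hz
    rw [h64 z hz]
    refine (norm_circleAverage_le_circleAverage_norm _ _ _).trans (le_of_eq ?_)
    apply circleAverage_congr_sphere
    intro w hw
    rw [abs_of_pos hR] at hw
    have hwR : ‖w‖ = R := by simpa using hw
    simp only [norm_mul, norm_div, norm_pow, Complex.norm_real, Real.norm_eq_abs, hwR,
      Complex.norm_ofNat, norm_sub_rev]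
    rw [div_eq_mul_inv]
  /- Step 4: `⨍_{|w|=R} log|g| = Re h(0) = 0` and `⨍_{|w|=R} |log|g|| = 2 m(R, g)`. -/
  set m := circleAverage (fun z ↦ log⁺ ‖g z‖) 0 R with hm
  have hm0 : 0 ≤ m := circleAverage_nonneg_of_nonneg fun _ _ ↦ posLog_nonneg
  have hlogc : ContinuousOn (fun w ↦ Real.log ‖g w‖) (sphere (0 : ℂ) R) :=
    ContinuousOn.log (continuous_norm.comp_continuousOn (hgc.mono hsR))
      fun w hw ↦ (norm_pos_iff.mpr (hg0' w (hsR hw))).ne'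
  have hmean0 : circleAverage (fun w ↦ Real.log ‖g w‖) 0 R = 0 := by
    have hdc : DiffContOnCl ℂ h (ball (0 : ℂ) |R|) := by
      rw [abs_of_pos hR]
      refine DifferentiableOn.diffContOnCl (hhd.mono ?_)
      rw [closure_ball (0 : ℂ) hR.ne']
      exact hbR
    have hint : CircleIntegrable h 0 R := by
      refine ContinuousOn.circleIntegrable hR.le ?_
      exact hhd.continuousOn.mono hsR
    have key := ContinuousLinearMap.circleAverage_comp_comm Complex.reCLM hint
    rw [hdc.circleAverage, Complex.reCLM_apply, hh0, Complex.zero_re] at key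
    rw [← key]
    apply circleAverage_congr_sphere
    intro w hw
    rw [abs_of_pos hR] at hw
    simp [hre w (hsR hw)]
  have habs : circleAverage (fun w ↦ |Real.log ‖g w‖|) 0 R = 2 * m := by
    have hpt : (fun w ↦ |Real.log ‖g w‖|) =
        (fun w ↦ (2 : ℝ) • log⁺ ‖g w‖) - fun w ↦ Real.log ‖g w‖ := by
      funext w
      simp only [Pi.sub_apply, smul_eq_mul]
      linarith [half_mul_log_add_log_abs (x := ‖g w‖)]
    have hi1 : CircleIntegrable (fun w ↦ (2 : ℝ) • log⁺ ‖g w‖) 0 R := by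
      refine ContinuousOn.circleIntegrable hR.le (continuousOn_const.fun_smul ?_)
      exact ((by fun_prop : Continuous fun x : ℝ ↦ log⁺ x).comp_continuousOn
        (continuous_norm.comp_continuousOn (hgc.mono hsR)))
    have hi2 : CircleIntegrable (fun w ↦ Real.log ‖g w‖) 0 R := hlogc.circleIntegrable hR.le
    rw [hpt, circleAverage_sub hi1 hi2, circleAverage_fun_smul, hmean0, sub_zero, smul_eq_mul]
  /- Step 5: integrate over `|z| = r`, swap the integrals and use (6.5). -/
  have h5 : circleAverage (fun z ↦ ‖deriv g z / g z‖) 0 r ≤ 4 * R * m / (R ^ 2 - r ^ 2) := by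
    have hRr : 0 < R ^ 2 - r ^ 2 := by nlinarith
    -- joint continuity of the kernel on the torus `|z| = r`, `|w| = R`
    have hne : ∀ θ φ : ℝ, circleMap 0 R φ - circleMap 0 r θ ≠ 0 := by
      intro θ φ h0
      have h1 : ‖circleMap 0 R φ‖ = ‖circleMap 0 r θ‖ := by rw [sub_eq_zero.mp h0]
      simp [abs_of_pos hR, abs_of_pos hr] at h1
      linarith
    have hgφ : Continuous fun φ : ℝ ↦ g (circleMap 0 R φ) :=
      hgc.comp_continuous (continuous_circleMap 0 R)
        fun φ ↦ hsR (circleMap_mem_sphere 0 hR.le φ)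
    have hgφ0 : ∀ φ : ℝ, ‖g (circleMap 0 R φ)‖ ≠ 0 := fun φ ↦
      (norm_pos_iff.mpr (hg0' _ (hsR (circleMap_mem_sphere 0 hR.le φ)))).ne'
    have hF : Continuous fun p : ℝ × ℝ ↦ 2 * R * (‖circleMap 0 R p.2 - circleMap 0 r p.1‖ ^ 2)⁻¹ *
        |Real.log ‖g (circleMap 0 R p.2)‖| := by
      refine Continuous.mul (Continuous.mul continuous_const ?_) ?_
      · refine Continuous.inv₀ (by fun_prop) fun p ↦ pow_ne_zero 2 (norm_ne_zero_iff.mpr (hne p.1 p.2))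
      · exact continuous_abs.comp ((Real.continuousOn_log.comp_continuous
          (continuous_norm.comp (hgφ.comp continuous_snd)) fun p ↦ hgφ0 p.2))
    calc circleAverage (fun z ↦ ‖deriv g z / g z‖) 0 r
        ≤ circleAverage (fun z ↦ circleAverage
            (fun w ↦ 2 * R * (‖w - z‖ ^ 2)⁻¹ * |Real.log ‖g w‖|) 0 R) 0 r := by
          refine circleAverage_mono ?_ ?_ fun z hz ↦ h3 z (hsr (by rwa [abs_of_pos hr] at hz))
          · refine ContinuousOn.circleIntegrable hr.le ?_
            exact continuous_norm.comp_continuousOn (hdgc.mono (hsr.trans (ball_subset_ball hRR'.le)))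
          · -- continuity of the inner average in `z` on `|z| = r`, via the torus parametrisation
            rw [CircleIntegrable]
            refine Continuous.intervalIntegrable ?_ _ _
            have : (fun θ : ℝ ↦ circleAverage
                (fun w ↦ 2 * R * (‖w - circleMap 0 r θ‖ ^ 2)⁻¹ * |Real.log ‖g w‖|) 0 R) =
                fun θ ↦ (2 * π)⁻¹ • ∫ φ in (0 : ℝ)..2 * π, 2 * R *
                  (‖circleMap 0 R φ - circleMap 0 r θ‖ ^ 2)⁻¹ * |Real.log ‖g (circleMap 0 R φ)‖| := by
              funext θ; rfl
            rw [this]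
            exact (continuous_const_smul _).comp
              (intervalIntegral.continuous_parametric_intervalIntegral_of_continuous'
                (f := fun θ φ ↦ 2 * R * (‖circleMap 0 R φ - circleMap 0 r θ‖ ^ 2)⁻¹ *
                  |Real.log ‖g (circleMap 0 R φ)‖|) hF 0 (2 * π))
      _ = circleAverage (fun w ↦ circleAverage
            (fun z ↦ 2 * R * (‖w - z‖ ^ 2)⁻¹ * |Real.log ‖g w‖|) 0 r) 0 R :=
          circleAverage_circleAverage_swap
            (F := fun z w ↦ 2 * R * (‖w - z‖ ^ 2)⁻¹ * |Real.log ‖g w‖|) hF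
      _ = circleAverage (fun w ↦ (2 * R * (R ^ 2 - r ^ 2)⁻¹) • |Real.log ‖g w‖|) 0 R := by
          apply circleAverage_congr_sphere
          intro w hw
          rw [abs_of_pos hR] at hw
          have hwR : ‖w‖ = R := by simpa using hw
          have hrw : (fun z ↦ 2 * R * (‖w - z‖ ^ 2)⁻¹ * |Real.log ‖g w‖|) =
              fun z ↦ (2 * R * |Real.log ‖g w‖|) • (‖w - z‖ ^ 2)⁻¹ := by
            funext z; simp only [smul_eq_mul]; ring
          beta_reduce
          rw [hrw, circleAverage_fun_smul, circleAverage_inv_norm_sub_sq hr.le hrR hwR, smul_eq_mul,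
            smul_eq_mul]
          ring
      _ = 2 * R * (R ^ 2 - r ^ 2)⁻¹ * (2 * m) := by
          rw [circleAverage_fun_smul, habs, smul_eq_mul]
      _ = 4 * R * m / (R ^ 2 - r ^ 2) := by
          field_simp
          ring
  /- Step 6: Jensen, and the final comparison. -/
  have hq : Continuous fun θ : ℝ ↦ ‖deriv g (circleMap 0 r θ) / g (circleMap 0 r θ)‖ :=
    continuous_norm.comp (hdgc.comp_continuous (continuous_circleMap 0 r) fun θ ↦
      (hsr.trans (ball_subset_ball hRR'.le)) (circleMap_mem_sphere 0 hr.le θ))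
  have h6 := circleAverage_posLog_le_posLog_circleAverage_add
    (q := fun z ↦ ‖deriv g z / g z‖) (c := 0) (r := r) hq (fun θ ↦ norm_nonneg _)
  have h7 : log⁺ (circleAverage (fun z ↦ ‖deriv g z / g z‖) 0 r) ≤
      log⁺ (4 * R * m / (R ^ 2 - r ^ 2)) :=
    posLog_le_posLog (circleAverage_nonneg_of_nonneg fun _ _ ↦ norm_nonneg _) h5
  have h8 := posLog_four_mul_div_lt hr hrR hm0
  linarith

/-- The same statement in the notation of Mathlib's value distribution theory: the proximity
function of `g'/g` at `∞` on the circle of radius `r`. [cite: CalegariDimitrovTang2025,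
Lemma 6.1.2] -/
theorem proximity_logDeriv_lt {g : ℂ → ℂ} {r R : ℝ} (hr : 0 < r) (hrR : r < R)
    (hg : AnalyticOnNhd ℂ g (closedBall 0 R)) (hg0 : ∀ z ∈ closedBall (0 : ℂ) R, g z ≠ 0)
    (hg1 : g 0 = 1) :
    ValueDistribution.proximity (fun z ↦ deriv g z / g z) ⊤ r <
      log⁺ (ValueDistribution.proximity g ⊤ R / r * (R / (R - r))) + Real.log 2 + Real.exp (-1) := by
  rw [ValueDistribution.proximity_top, ValueDistribution.proximity_top]
  exact circleAverage_posLog_norm_logDeriv_lt hr hrR hg hg0 hg1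

end Literature.Analysis.Complex
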